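import Literature.AlgebraicGeometry.Frobenioids.EquivalencePreStepsFSMType
import Literature.AlgebraicGeometry.Frobenioids.IrreducibleMorphismsDivIdentity
import Literature.AlgebraicGeometry.Frobenioids.PullbackLinear
import HarnessLib

/-!
# Frobenioids I, §3: Theorem 3.4 (iii), steps (F1), (F2) — `Div`-identity prime-Frobenius
# endomorphisms and admissibility squares (isotropic type, FSM-type bases, non-dilating monoids)

Mochizuki, *The geometry of Frobenioids I: the general theory*, Kyushu J. Math. **62** (2008),
Thm. 3.4 (iii), proof, assertion (F1), kurims p. 65: "Since [by assertion (ii)] `Ψ` preserves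
pre-steps, it thus follows formally from the characterization of 'Div-identity prime-Frobenius
endomorphisms' given in Proposition 1.14, (v), that `Ψ` maps `φ₁` to a prime-Frobenius endomorphism
of `A₂ = Ψ(A₁)`" [cite: MochizukiFrdI2008, Thm. 3.4 (iii) p.65].

PROOF-ONLY (seat abc-iut-L1-t13; the cell's repair programme — assertion (ii) is used in the form
`FrdI.isPreStep_map_of_isOfFSMType`, i.e. over bases of FSM-type, instead of the printed route):
for Frobenioids `C₁`, `C₂` of isotropic type over bases of FSM-type with non-dilating divisor monoids
and an equivalence `Ψ`, a `Div`-identity prime-Frobenius endomorphism of a non-group-like object is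
mapped to a `Div`-identity prime-Frobenius endomorphism (`FrdI.isDivIdentity_isPrimeFrobenius_map`),
by transporting the square condition of Prop. 1.14 (v) (seat abc-iut-L1-t11's
`exists_square_of_isDivIdentity_isPrimeFrobenius` / `isDivIdentity_isPrimeFrobenius_of_squares`)
along `Ψ`: steps, irreducible non-pre-steps and non-group-like objects are preserved and reflected.
Then (F2) (admissibility propagates along pre-steps by Prop. 1.10 (i) + Prop. 1.14 (iv), and along
pull-back morphisms into Frobenius-trivial objects by Prop. 1.11 (iii) + Prop. 1.14 (iv)); the
conclusion (`Ψ` preserves prime-Frobenius morphisms / Frobenius type) is drawn in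
`EquivalenceFrobeniusType.lean`. No statement of the paper is restated or strengthened.
-/

set_option backward.isDefEq.respectTransparency false

namespace Literature.AlgebraicGeometry.Frobenioids

open CategoryTheory Opposite

universe w v v' u u'

namespace FrdI

section Two

variable {D₁ : Type u} [Category.{v} D₁] {Φ₁ : D₁ᵒᵖ ⥤ CommMonCat.{w}} {C₁ : Type u'}
  [Category.{v'} C₁] {D₂ : Type u} [Category.{v} D₂] {Φ₂ : D₂ᵒᵖ ⥤ CommMonCat.{w}} {C₂ : Type u'}
  [Category.{v'} C₂] {F₁ : C₁ ⥤ ElemFrobenioid Φ₁} {F₂ : C₂ ⥤ ElemFrobenioid Φ₂}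

/-- Over bases of FSM-type an equivalence between Frobenioids of isotropic type maps steps to steps
(pre-steps are preserved, isomorphisms reflected). [cite: MochizukiFrdI2008, Thm. 3.4 (ii) p.62] -/
theorem isStep_map_of_isOfFSMType' (hF₁ : PreFrobenioid.IsFrobenioid F₁)
    (hF₂ : PreFrobenioid.IsFrobenioid F₂) (hi₁ : ∀ A : C₁, PreFrobenioid.IsIsotropic F₁ A)
    (hi₂ : ∀ A : C₂, PreFrobenioid.IsIsotropic F₂ A) (hD₂ : IsOfFSMType D₂) (Ψ : C₁ ≌ C₂)
    {A B : C₁} {α : A ⟶ B} (hα : PreFrobenioid.IsStep F₁ α) :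
    PreFrobenioid.IsStep F₂ (Ψ.functor.map α) :=
  ⟨isPreStep_map_of_isOfFSMType hF₁ hF₂ hi₁ hi₂ hD₂ Ψ hα.1,
    fun _ => hα.2 (isIso_of_fully_faithful Ψ.functor α)⟩

/-- A pre-step `Ψ(φ)` comes from a pre-step `φ` (apply pre-step preservation to `Ψ⁻¹` and conjugate
by the unit). [cite: MochizukiFrdI2008, Thm. 3.4 (ii) p.62] -/
theorem isPreStep_of_map_of_isOfFSMType (hF₁ : PreFrobenioid.IsFrobenioid F₁)
    (hF₂ : PreFrobenioid.IsFrobenioid F₂) (hi₁ : ∀ A : C₁, PreFrobenioid.IsIsotropic F₁ A)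
    (hi₂ : ∀ A : C₂, PreFrobenioid.IsIsotropic F₂ A) (hD₁ : IsOfFSMType D₁) (Ψ : C₁ ≌ C₂)
    {A B : C₁} {φ : A ⟶ B} (h : PreFrobenioid.IsPreStep F₂ (Ψ.functor.map φ)) :
    PreFrobenioid.IsPreStep F₁ φ := by
  have h1 := isPreStep_map_of_isOfFSMType hF₂ hF₁ hi₂ hi₁ hD₁ Ψ.symm h
  change PreFrobenioid.IsPreStep F₁ (Ψ.inverse.map (Ψ.functor.map φ)) at h1
  rw [Ψ.inv_fun_map] at h1
  have e : φ = Ψ.unit.app A ≫ (Ψ.unitInv.app A ≫ φ ≫ Ψ.unit.app B) ≫ Ψ.unitInv.app B := by simp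
  rw [e]
  exact PreFrobenioid.IsPreStep.comp F₁ (PreFrobenioid.isPreStep_of_isIso F₁ _)
    (PreFrobenioid.IsPreStep.comp F₁ h1 (PreFrobenioid.isPreStep_of_isIso F₁ _))

/-- Group-like objects are invariant under isomorphism (pull back along the base isomorphism).
[cite: MochizukiFrdI2008, Def. 1.2 (iv) p.23] -/
theorem isGroupLikeObj_of_iso (hP₁ : IsPreFrobenioid Φ₁ F₁) {A A' : C₁} (i : A ≅ A')
    (hA : PreFrobenioid.IsGroupLikeObj F₁ A) : PreFrobenioid.IsGroupLikeObj F₁ A' := by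
  intro x
  have hx : x = pull Φ₁ (PreFrobenioid.Base F₁ i.inv) (pull Φ₁ (PreFrobenioid.Base F₁ i.hom) x) := by
    rw [← pull_comp, ← PreFrobenioid.base_comp, i.inv_hom_id, PreFrobenioid.base_id, pull_id]
  have := hP₁.isMonoidOn
  rw [hx, hA (pull Φ₁ (PreFrobenioid.Base F₁ i.hom) x), map_one]

/-- **Thm. 3.4 (iii), (F1) core: `Ψ` preserves `Div`-identity prime-Frobenius endomorphisms of
non-group-like objects** (Frobenioids of isotropic type over bases of FSM-type, `Φ₁`, `Φ₂`
non-dilating; via Prop. 1.14 (v)). [cite: MochizukiFrdI2008, Thm. 3.4 (iii) p.65] -/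
theorem isDivIdentity_isPrimeFrobenius_map (hF₁ : PreFrobenioid.IsFrobenioid F₁)
    (hF₂ : PreFrobenioid.IsFrobenioid F₂) (hi₁ : ∀ A : C₁, PreFrobenioid.IsIsotropic F₁ A)
    (hi₂ : ∀ A : C₂, PreFrobenioid.IsIsotropic F₂ A) (hD₁ : IsOfFSMType D₁) (hD₂ : IsOfFSMType D₂)
    (hnd₂ : IsNonDilatingOn Φ₂) (Ψ : C₁ ≌ C₂) {A : C₁} (hA : ¬ PreFrobenioid.IsGroupLikeObj F₁ A)
    {φ : A ⟶ A} (hdi : PreFrobenioid.IsDivIdentity F₁ φ) (hpf : PreFrobenioid.IsPrimeFrobenius F₁ φ) :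
    PreFrobenioid.IsDivIdentity F₂ (Ψ.functor.map φ) ∧
      PreFrobenioid.IsPrimeFrobenius F₂ (Ψ.functor.map φ) := by
  have hP₁ := hF₁.isPreFrobenioid
  refine PreFrobenioid.isDivIdentity_isPrimeFrobenius_of_squares F₂ hF₂ hi₂ hnd₂ ?_ ?_ ?_ ?_
  · -- `Ψ φ` is not a pre-step (else `φ` would be one, of prime degree)
    intro h
    have h1 := isPreStep_of_map_of_isOfFSMType hF₁ hF₂ hi₁ hi₂ hD₁ Ψ h
    have hd : (PreFrobenioid.degFr F₁ φ : ℕ) = 1 := by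
      rw [show PreFrobenioid.degFr F₁ φ = 1 from h1.1, PNat.one_coe]
    exact (Nat.Prime.one_lt hpf.2).ne' hd
  · exact (hpf.isIrreducibleHom hF₁ (hi₁ A)).map_equivalence Ψ
  · -- `Ψ A` is not group-like
    intro hGA
    have h1 := isGroupLikeObj_map_of_isOfFSMType hF₂ hF₁ hi₂ hi₁ hD₂ Ψ.symm hGA
    exact hA (isGroupLikeObj_of_iso hP₁ (Ψ.unitIso.app A).symm h1)
  · -- the squares of Prop. 1.14 (v), transported along `Ψ`
    intro B₂ α₂ hα₂
    -- pull the step back to `C₁`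
    let α₁ : A ⟶ Ψ.inverse.obj B₂ := Ψ.unit.app A ≫ Ψ.inverse.map α₂
    have hα₁p : PreFrobenioid.IsPreStep F₁ α₁ :=
      PreFrobenioid.IsPreStep.comp F₁ (PreFrobenioid.isPreStep_of_isIso F₁ _)
        (isPreStep_map_of_isOfFSMType hF₂ hF₁ hi₂ hi₁ hD₁ Ψ.symm hα₂.1)
    have hα₁ : PreFrobenioid.IsStep F₁ α₁ := by
      refine ⟨hα₁p, fun h => hα₂.2 ?_⟩
      haveI : IsIso (Ψ.unit.app A ≫ Ψ.inverse.map α₂) := h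
      haveI : IsIso (Ψ.inverse.map α₂) := IsIso.of_isIso_comp_left (Ψ.unit.app A) (Ψ.inverse.map α₂)
      exact isIso_of_fully_faithful Ψ.inverse α₂
    obtain ⟨B', ψ₁, β₁, ⟨hψirr, hψnps⟩, hβ₁, hsq⟩ :=
      PreFrobenioid.exists_square_of_isDivIdentity_isPrimeFrobenius F₁ hF₁ hi₁ hdi hpf α₁ hα₁
    -- hsq : α₁ ≫ ψ₁ = φ ≫ α₁ ≫ β₁ ; push forward: `Ψ α₁ = α₂ ≫ ε⁻¹`
    have hmap : Ψ.functor.map α₁ = α₂ ≫ Ψ.counitInv.app B₂ := by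
      simp only [α₁, Functor.map_comp, Equivalence.fun_inv_map, Equivalence.functor_unit_comp_assoc]
    have hsq₂ := congrArg Ψ.functor.map hsq
    simp only [Functor.map_comp, hmap, Category.assoc] at hsq₂
    -- hsq₂ : α₂ ≫ ε⁻¹ ≫ Ψ ψ₁ = Ψ φ ≫ α₂ ≫ ε⁻¹ ≫ Ψ β₁
    refine ⟨Ψ.functor.obj B', Ψ.counitInv.app B₂ ≫ Ψ.functor.map ψ₁,
      Ψ.counitInv.app B₂ ≫ Ψ.functor.map β₁, ⟨?_, ?_⟩, ⟨?_, ?_⟩, hsq₂⟩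
    · exact (hψirr.map_equivalence Ψ).of_arrow_iso (Ψ.counitIso.app B₂) (Iso.refl _) (by simp)
    · intro h
      apply hψnps
      apply isPreStep_of_map_of_isOfFSMType hF₁ hF₂ hi₁ hi₂ hD₁ Ψ
      have e : Ψ.functor.map ψ₁ = Ψ.counit.app B₂ ≫ (Ψ.counitInv.app B₂ ≫ Ψ.functor.map ψ₁) := by simp
      rw [e]
      exact PreFrobenioid.IsPreStep.comp F₂ (PreFrobenioid.isPreStep_of_isIso F₂ _) h
    · exact PreFrobenioid.IsPreStep.comp F₂ (PreFrobenioid.isPreStep_of_isIso F₂ _)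
        (isStep_map_of_isOfFSMType' hF₁ hF₂ hi₁ hi₂ hD₂ Ψ hβ₁).1
    · intro h
      haveI : IsIso (Ψ.counitInv.app B₂ ≫ Ψ.functor.map β₁) := h
      exact (isStep_map_of_isOfFSMType' hF₁ hF₂ hi₁ hi₂ hD₂ Ψ hβ₁).2
        (IsIso.of_isIso_comp_left (Ψ.counitInv.app B₂) (Ψ.functor.map β₁))

/-! ### (F2): admissibility propagates along pre-steps and along pull-back morphisms -/

/-- **(F2), pre-step case.** Along a pre-step `ζ : A → B`, the images of the `p₁`-Frobenius
morphisms out of `A` and out of `B` are simultaneously prime-Frobenius, of the same degree (Frobenius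
conjugation, Prop. 1.10 (i); Prop. 1.14 (iv) applied to the image square, whose pre-step sides keep
degree `1` over bases of FSM-type). [cite: MochizukiFrdI2008, Thm. 3.4 (iii) p.65] -/
theorem isPrimeFrobenius_map_iff_of_isPreStep (hF₁ : PreFrobenioid.IsFrobenioid F₁)
    (hF₂ : PreFrobenioid.IsFrobenioid F₂) (hi₁ : ∀ A : C₁, PreFrobenioid.IsIsotropic F₁ A)
    (hi₂ : ∀ A : C₂, PreFrobenioid.IsIsotropic F₂ A) (hD₂ : IsOfFSMType D₂) (Ψ : C₁ ≌ C₂)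
    {A B A' B' : C₁} {ζ : A ⟶ B} (hζ : PreFrobenioid.IsPreStep F₁ ζ) {fA : A ⟶ A'} {fB : B ⟶ B'}
    (hfA : PreFrobenioid.IsFrobeniusType F₁ fA) (hfB : PreFrobenioid.IsFrobeniusType F₁ fB)
    (hd : PreFrobenioid.degFr F₁ fA = PreFrobenioid.degFr F₁ fB)
    (hp : (PreFrobenioid.degFr F₁ fA : ℕ).Prime) :
    (PreFrobenioid.IsPrimeFrobenius F₂ (Ψ.functor.map fA) ↔
        PreFrobenioid.IsPrimeFrobenius F₂ (Ψ.functor.map fB)) ∧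
      PreFrobenioid.degFr F₂ (Ψ.functor.map fA) = PreFrobenioid.degFr F₂ (Ψ.functor.map fB) := by
  obtain ⟨ζ', hsq, -⟩ := PreFrobenioid.existsUnique_frobeniusConjugate hF₁ ζ hfA hfB hd
  -- hsq : fA ≫ ζ' = ζ ≫ fB
  have hζ' : PreFrobenioid.IsPreStep F₁ ζ' := hζ.frobeniusConjugate hF₁ hsq hfA hfB hd
  have hsq₂ : Ψ.functor.map ζ ≫ Ψ.functor.map fB = Ψ.functor.map fA ≫ Ψ.functor.map ζ' := by
    rw [← Functor.map_comp, ← Functor.map_comp, hsq]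
  have h1 : PreFrobenioid.degFr F₂ (Ψ.functor.map ζ) = PreFrobenioid.degFr F₂ (Ψ.functor.map ζ') := by
    rw [show PreFrobenioid.degFr F₂ (Ψ.functor.map ζ) = 1 from
        (isPreStep_map_of_isOfFSMType hF₁ hF₂ hi₁ hi₂ hD₂ Ψ hζ).1,
      show PreFrobenioid.degFr F₂ (Ψ.functor.map ζ') = 1 from
        (isPreStep_map_of_isOfFSMType hF₁ hF₂ hi₁ hi₂ hD₂ Ψ hζ').1]
  have hpA : PreFrobenioid.IsPrimeFrobenius F₁ fA := ⟨hfA, hp⟩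
  have hpB : PreFrobenioid.IsPrimeFrobenius F₁ fB := ⟨hfB, by rw [← hd]; exact hp⟩
  obtain ⟨hiff, hdeg⟩ := PreFrobenioid.isPrimeFrobenius_iff_of_square F₂ hF₂ hi₂ hsq₂ h1
    ((hpB.isIrreducibleHom hF₁ (hi₁ _)).map_equivalence Ψ)
    ((hpA.isIrreducibleHom hF₁ (hi₁ _)).map_equivalence Ψ)
  exact ⟨hiff.symm, hdeg.symm⟩

/-- **(F2), pull-back case** (Prop. 1.11 (iii)): a base-identity endomorphism of Frobenius type `ψ`
of `B` lifts along a pull-back morphism `ζ : A → B` to a base-identity endomorphism of Frobenius type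
`φ` of `A` of the same degree with `ζ ≫ ψ = φ ≫ ζ`. [cite: MochizukiFrdI2008, Thm. 3.4 (iii) p.65] -/
theorem exists_frobenius_endo_lift (hF₁ : PreFrobenioid.IsFrobenioid F₁)
    (hi₁ : ∀ A : C₁, PreFrobenioid.IsIsotropic F₁ A) {A B : C₁} {ζ : A ⟶ B}
    (hζ : PreFrobenioid.IsPullbackMorphism F₁ ζ) {ψ : B ⟶ B} (hψ : PreFrobenioid.IsFrobeniusType F₁ ψ)
    (hψb : PreFrobenioid.IsBaseIdentity F₁ ψ) :
    ∃ φ : A ⟶ A, PreFrobenioid.IsFrobeniusType F₁ φ ∧ PreFrobenioid.IsBaseIdentity F₁ φ ∧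
      PreFrobenioid.degFr F₁ φ = PreFrobenioid.degFr F₁ ψ ∧ ζ ≫ ψ = φ ≫ ζ := by
  have hP₁ := hF₁.isPreFrobenioid
  obtain ⟨φ, ⟨hφb, hsq⟩, -⟩ := PreFrobenioid.existsUnique_endo_lift hζ ψ (𝟙 _)
    (by rw [show PreFrobenioid.Base F₁ ψ = 𝟙 _ from hψb, Category.comp_id, Category.id_comp])
  -- degree and zero divisor of `φ` from the square
  obtain ⟨⟨-, hζi⟩, hζl⟩ := hF₁.iv_b ζ hζ
  have hdeg : PreFrobenioid.degFr F₁ φ = PreFrobenioid.degFr F₁ ψ := by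
    have := congrArg (PreFrobenioid.degFr F₁) hsq
    rw [PreFrobenioid.degFr_comp, PreFrobenioid.degFr_comp,
      show PreFrobenioid.degFr F₁ ζ = 1 from hζl, one_mul, mul_one] at this
    exact this.symm
  have hdiv : PreFrobenioid.Div F₁ φ = 1 := by
    have := congrArg (PreFrobenioid.Div F₁) hsq
    rw [PreFrobenioid.div_comp, PreFrobenioid.div_comp, show PreFrobenioid.Div F₁ ζ = 1 from hζi,
      show PreFrobenioid.Div F₁ ψ = 1 from hψ.1.2, map_one, one_pow, one_mul, map_one, one_mul,
      show PreFrobenioid.degFr F₁ ζ = 1 from hζl, PNat.one_coe, pow_one] at this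
    exact this.symm
  have hb : IsIso (PreFrobenioid.Base F₁ φ) := by rw [hφb]; infer_instance
  exact ⟨φ, ⟨⟨PreFrobenioid.isCoAngular_of_isIsotropic_codomains F₁ φ (fun X _ => hi₁ X), hdiv⟩,
    hb⟩, hφb, hdeg, hsq⟩

/-- **(F2), pull-back case, conclusion.** For a pull-back morphism `ζ : A → B` and base-identity
endomorphisms of Frobenius type `φ` of `A`, `ψ` of `B` of the same prime degree with `ζ ≫ ψ = φ ≫ ζ`,
`Ψ(φ)` is prime-Frobenius iff `Ψ(ψ)` is, with equal degrees (Prop. 1.14 (iv)).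
[cite: MochizukiFrdI2008, Thm. 3.4 (iii) p.65] -/
theorem isPrimeFrobenius_map_iff_of_isPullbackMorphism (hF₁ : PreFrobenioid.IsFrobenioid F₁)
    (hF₂ : PreFrobenioid.IsFrobenioid F₂) (hi₁ : ∀ A : C₁, PreFrobenioid.IsIsotropic F₁ A)
    (hi₂ : ∀ A : C₂, PreFrobenioid.IsIsotropic F₂ A) (Ψ : C₁ ≌ C₂) {A B : C₁} {ζ : A ⟶ B}
    {φ : A ⟶ A} {ψ : B ⟶ B} (hφ : PreFrobenioid.IsPrimeFrobenius F₁ φ)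
    (hψ : PreFrobenioid.IsPrimeFrobenius F₁ ψ) (hsq : ζ ≫ ψ = φ ≫ ζ) :
    (PreFrobenioid.IsPrimeFrobenius F₂ (Ψ.functor.map φ) ↔
        PreFrobenioid.IsPrimeFrobenius F₂ (Ψ.functor.map ψ)) ∧
      PreFrobenioid.degFr F₂ (Ψ.functor.map φ) = PreFrobenioid.degFr F₂ (Ψ.functor.map ψ) := by
  have hsq₂ : Ψ.functor.map ζ ≫ Ψ.functor.map ψ = Ψ.functor.map φ ≫ Ψ.functor.map ζ := by
    rw [← Functor.map_comp, ← Functor.map_comp, hsq]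
  obtain ⟨hiff, hdeg⟩ := PreFrobenioid.isPrimeFrobenius_iff_of_square F₂ hF₂ hi₂ hsq₂ rfl
    ((hψ.isIrreducibleHom hF₁ (hi₁ _)).map_equivalence Ψ)
    ((hφ.isIrreducibleHom hF₁ (hi₁ _)).map_equivalence Ψ)
  exact ⟨hiff.symm, hdeg.symm⟩

end Two

end FrdI

end Literature.AlgebraicGeometry.Frobenioids
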